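import Literature.NumberTheory.PAdicHodge.BdRPlusLogTeichUnit
import Literature.NumberTheory.PAdicHodge.TiltUntiltKernel
import Literature.NumberTheory.PAdicHodge.PadicFieldUnitLogHasSum
import HarnessLib

/-!
# `ℓ_{uⁿ} = n · ℓ_u + c · t`: the `B_dR⁺`-integral of the Kummer cocycle of a power, and principal units with prescribed logarithm

Topic `Literature/NumberTheory/PAdicHodge`; THEOREMS ONLY (no definition, no named fact, no instance, no `sorry`). Sequel of
`BdRKummerUnitPeriod` / `TateTwistPeriodLine` (`ℓ_u = unitKummerLog = log([ũ]·u⁻¹)`, `ũ = rootTilt u` a CHOSEN `p`-power root system),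
`TiltUntiltKernel` (`x♯ = y♯ ⟹ x = ε^a y`) and `BdRPlusLogTeichUnit` (the junction `log[ũ] ≡ ℓ_u + ι_F(log_p u)` for `u ≡ 1 (mod p)`).
Two pieces of bookkeeping used when the assembly socket `ReciprocityCalibrationSocket.tatePairingPoint_eq_neg_trace_of_recognition`
is fed a calibration unit:

* §1–§3 ★ `exists_unitKummerLog_pow_eq` — **`ℓ_{uⁿ} = n · ℓ_u + ι(ε^c)` for some `c ∈ ℤ_p`**: the root system chosen for `uⁿ` is
  `ε^c · ũⁿ` (`rootTilt_isUnit`, `exists_rootTilt_pow_eq`: both untilt to `uⁿ`), `[ε^c ũⁿ]·u^{-n} = [ε^c]·([ũ]u⁻¹)ⁿ` and `log` is additive on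
  `1 + Fil¹` (`logOneAdd_mul_sub_one`, `logOneAdd_pow_sub_one`, `log[ε^c] = c·t`). So a multiple `p^B ψ(τ)·ℓ_u` of the calibration term
  is `ψ(τ)·ℓ_{u^{p^B}}` up to the `ι(ℤ_p(1))`-valued continuous cochain `τ ↦ ε^{c ψ(τ)}`.
* §4 ★ `PadicField.exists_one_unit_unitLog_eq_pow_smul` — **every `a ∈ F` is `p^{-k} log_p u` for a unit `u ≡ 1 (mod p)`** (indeed
  `‖1 − u‖ ≤ ‖p‖²`) and every `k ≥ k₀`: the logarithm series is onto the ball `{‖z‖ ≤ ‖p‖²}` from `{‖1 − u‖ ≤ ‖p‖²}` (IUT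
  `exists_logSeries_eq`); and for such `u` the root system has `ũ₀ = 1` (`coeff_zero_rootTilt_eq_one_of_norm_sub_one_le`), the hypothesis of
  the junction `IsLogModFil.sub_unitKummerLog_sub_embBdRHom_unitLog_mem`.

Line `kato_lever` of crux K★ `stmt-BirchSwinnertonDyer-22226` ((H4) step (3) assembly); BSD / K★ / [REC] are NOT proved by any of this.

## References
* S. Bloch, K. Kato (1990), Ex. 3.10.1 (`Kummer = exp` for `𝔾_m`). [BlochKato1990]
* K. Kato, LNM 1553 (1993), Ch. II §1.4.4, proof of Lemma 1.4.5 (reduction to `a = log u`). [Kato1993LNM1553]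
* J.-M. Fontaine, Astérisque 223 (1994), Exp. II §1.2.2, §1.5.4. [FontaineAsterisque223III]
* J. Neukirch, *Algebraic Number Theory* (1999), Ch. II (5.5) (`log : U^{(n)} ≅ 𝔭ⁿ`). [NeukirchANT1999]
-/

noncomputable section

namespace Literature.NumberTheory.PAdicHodge

open ValuativeRel Field Ideal WittVector
open Literature.NumberTheory.GaloisRepresentations Literature.NumberTheory.GaloisRepresentations.IsNonarchimedeanLocalField
open Literature.NumberTheory.GaloisCohomology
open Literature.IUT.LogVolume

namespace BdRPlusTop

variable {F : Type} [Field F] [ValuativeRel F] [TopologicalSpace F] [IsNonarchimedeanLocalField F]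
  [CharZero F] {p : ℕ} [Fact p.Prime] [Fact (¬ IsUnit (p : integerC F))]
  [IsAdicComplete (Ideal.span {(p : integerC F)}) (integerC F)]

/-! ## §1 Root systems are units of the tilt; the root system of a power -/

omit [CharZero F] in
/-- The untilt of the root system of `u` times that of `u⁻¹` is `1` (`ũ♯ = u`). [cite: FontaineAsterisque223III, Exp. II §1.2.2] -/
theorem untilt_rootTilt_mul_rootTilt_inv {u : NormedAlgClosure F} (hu : u ≠ 0) (hu1 : ‖u‖ ≤ 1) (hu1' : ‖u⁻¹‖ ≤ 1) :
    (PreTilt.untilt (rootTilt p u hu1 * rootTilt p u⁻¹ hu1') : integerC F) = 1 := by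
  refine Subtype.ext ?_
  rw [map_mul, Subring.coe_mul, coe_untilt_rootTilt, coe_untilt_rootTilt, ← UniformSpace.Completion.coe_mul, mul_inv_cancel₀ hu]
  rfl

/-- ★ **The root system `ũ` of a unit `u` is a unit of `𝒪_{ℂ_F}♭`**: `ũ · (u⁻¹)~ = ε^c` is a unit. [cite: FontaineAsterisque223III, Exp. II §1.2.2] -/
theorem rootTilt_isUnit {u : NormedAlgClosure F} (hu : u ≠ 0) (hu1 : ‖u‖ ≤ 1) (hu1' : ‖u⁻¹‖ ≤ 1) : IsUnit (rootTilt p u hu1) := by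
  obtain ⟨c, hc⟩ := PreTilt.exists_eq_epsPow_of_untilt_eq_one (rootTilt p u hu1 * rootTilt p u⁻¹ hu1')
    (untilt_rootTilt_mul_rootTilt_inv hu hu1 hu1')
  refine IsUnit.of_mul_eq_one (rootTilt p u⁻¹ hu1' * epsPow (-c)) ?_
  rw [← mul_assoc, hc, ← epsPow_add, add_neg_cancel, epsPow_zero]

/-- ★ **The root system of `uⁿ` is `ε^c · ũⁿ`** for some `c ∈ ℤ_p` (both untilt to `uⁿ`; `TiltUntiltKernel`).
[cite: FontaineAsterisque223III, Exp. II §1.2.2–1.2.3] -/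
theorem exists_rootTilt_pow_eq {u w : NormedAlgClosure F} (hu : u ≠ 0) (hu1 : ‖u‖ ≤ 1) (hu1' : ‖u⁻¹‖ ≤ 1) {n : ℕ}
    (hw : w = u ^ n) (hw1 : ‖w‖ ≤ 1) : ∃ c : ℤ_[p], rootTilt p w hw1 = epsPow c * rootTilt p u hu1 ^ n := by
  obtain ⟨U, hU⟩ := rootTilt_isUnit (p := p) hu hu1 hu1'
  have h : (PreTilt.untilt (rootTilt p w hw1) : integerC F) =
      PreTilt.untilt ((U ^ n : (PreTilt (integerC F) p)ˣ) : PreTilt (integerC F) p) := by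
    refine Subtype.ext ?_
    rw [Units.val_pow_eq_pow_val, hU, map_pow, Subring.coe_pow, coe_untilt_rootTilt, coe_untilt_rootTilt, hw]
    exact map_pow (UniformSpace.Completion.coeRingHom : NormedAlgClosure F →+* CompletedAlgClosure F) u n
  obtain ⟨c, hc⟩ := PreTilt.exists_eq_epsPow_mul_of_untilt_eq (rootTilt p w hw1) (U ^ n) h
  exact ⟨c, by rw [hc, Units.val_pow_eq_pow_val, hU]⟩

/-! ## §2 `z(ε^c ũⁿ, uⁿ) = [ε^c] · z(ũ, u)ⁿ` and `ℓ_{uⁿ} = n ℓ_u + c t` -/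

variable (hp : valuation F p < 1) (hF : Function.Surjective (fontaineTheta (integerC F) p))

/-- `z(ε^c · v, w) = [ε^c] · z(v, u)ⁿ` when `w = uⁿ`... precisely: `kummerUnitElt (ε^c · ũⁿ) (uⁿ) = [ε^c] · (kummerUnitElt ũ u)ⁿ`
(`[·]`, `ι` multiplicative). [cite: FontaineAsterisque223III, Exp. II §1.5.4] -/
theorem kummerUnitElt_epsPow_mul_pow (c : ℤ_[p]) (v : PreTilt (integerC F) p) (u : NormedAlgClosure F) (n : ℕ) :
    kummerUnitElt hp hF (epsPow c * v ^ n) (u ^ n) =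
      ofAinf F p (teichmuller p (epsPow c : PreTilt (integerC F) p)) * kummerUnitElt hp hF v u ^ n := by
  rw [kummerUnitElt, kummerUnitElt, ← inv_pow]
  simp only [ofAinf, RingHom.coe_comp, RingEquiv.toRingHom_eq_coe, RingHom.coe_coe, Function.comp_apply, map_mul, map_pow]
  ring

/-- ★ **`ℓ(ε^c ũⁿ, uⁿ) = n · ℓ(ũ, u) + c · t`** (`log` additive on `1 + Fil¹`, `log[ε^c] = c·t`).
[cite: BlochKato1990, Ex. 3.10.1] [cite: FontaineAsterisque223III, Exp. II §1.5.4] -/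
theorem kummerUnitLog_epsPow_mul_pow (c : ℤ_[p]) {v v' : PreTilt (integerC F) p} {u : NormedAlgClosure F} (hu : u ≠ 0)
    (hv : ((PreTilt.untilt v : integerC F) : CompletedAlgClosure F) = (u : CompletedAlgClosure F)) (n : ℕ)
    (hvv : v' = epsPow c * v ^ n)
    (hv' : ((PreTilt.untilt v' : integerC F) : CompletedAlgClosure F) = ((u ^ n : NormedAlgClosure F) : CompletedAlgClosure F)) :
    (kummerUnitLog hp hF v' (u ^ n) (pow_ne_zero n hu) hv' : BdRPlusTop F p) =
      n * (kummerUnitLog hp hF v u hu hv : BdRPlusTop F p) + of F p (qpToBdR (c : ℚ_[p]) * tBdR) := by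
  subst hvv
  have hz := kummerUnitElt_sub_one_mem_filOne hp hF hu hv
  have hε := ofAinf_teichmuller_epsPow_sub_one_mem_filOne (F := F) (p := p) c
  have hzn := pow_sub_one_mem_filOne hz n
  have d1 : kummerUnitLog hp hF (epsPow c * v ^ n) (u ^ n) (pow_ne_zero n hu) hv' =
      logOneAdd ⟨kummerUnitElt hp hF (epsPow c * v ^ n) (u ^ n) - 1,
        kummerUnitElt_sub_one_mem_filOne hp hF (pow_ne_zero n hu) hv'⟩ := rfl
  have d2 : kummerUnitLog hp hF v u hu hv = logOneAdd ⟨kummerUnitElt hp hF v u - 1, hz⟩ := rfl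
  have e1 : logOneAdd ⟨kummerUnitElt hp hF (epsPow c * v ^ n) (u ^ n) - 1,
        kummerUnitElt_sub_one_mem_filOne hp hF (pow_ne_zero n hu) hv'⟩ =
      logOneAdd ⟨ofAinf F p (teichmuller p (epsPow c : PreTilt (integerC F) p)) * kummerUnitElt hp hF v u ^ n - 1,
        mul_sub_one_mem_filOne hε hzn⟩ :=
    logOneAdd_congr (by
      change kummerUnitElt hp hF (epsPow c * v ^ n) (u ^ n) - 1 =
        ofAinf F p (teichmuller p (epsPow c : PreTilt (integerC F) p)) * kummerUnitElt hp hF v u ^ n - 1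
      rw [kummerUnitElt_epsPow_mul_pow])
  rw [d1, d2, e1, logOneAdd_mul_sub_one hε hzn, logOneAdd_teichmuller_epsPow, logOneAdd_pow_sub_one hz n, add_comm]

/-- ★ **`ℓ_{uⁿ} = n · ℓ_u + c · t` for the CHOSEN root systems** (`rootTilt (uⁿ) = ε^c ũⁿ`). [cite: BlochKato1990, Ex. 3.10.1]
[cite: Kato1993LNM1553, Ch. II §1.4.4] -/
theorem exists_kummerUnitLog_rootTilt_pow_eq {u w : NormedAlgClosure F} (hu : u ≠ 0) (hu1 : ‖u‖ ≤ 1) (hu1' : ‖u⁻¹‖ ≤ 1) {n : ℕ}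
    (hw : w = u ^ n) (hw0 : w ≠ 0) (hw1 : ‖w‖ ≤ 1) :
    ∃ c : ℤ_[p], (kummerUnitLog hp hF (rootTilt p w hw1) w hw0 (coe_untilt_rootTilt w hw1) : BdRPlusTop F p) =
      n * (kummerUnitLog hp hF (rootTilt p u hu1) u hu (coe_untilt_rootTilt u hu1) : BdRPlusTop F p) +
        of F p (qpToBdR (c : ℚ_[p]) * tBdR) := by
  obtain ⟨c, hc⟩ := exists_rootTilt_pow_eq (p := p) hu hu1 hu1' hw hw1
  subst hw
  exact ⟨c, kummerUnitLog_epsPow_mul_pow hp hF c hu (coe_untilt_rootTilt u hu1) n hc (coe_untilt_rootTilt _ hw1)⟩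

/-! ## §3 For `u ∈ F`: `ℓ_{uⁿ} = n ℓ_u + ι(ε^c)` -/

omit [Fact (¬ IsUnit (p : integerC F))] [IsAdicComplete (Ideal.span {(p : integerC F)}) (integerC F)] [CharZero F] in
/-- `‖(ι u)⁻¹‖ ≤ 1` in `F̄` for a unit `u` of `F` (valuation `1`): the norm of `F̄` extends that of `F`.
[cite: NeukirchANT1999, Ch. II (4.8)] -/
theorem norm_algebraMap_inv_le_one_of_valuation_eq_one {u : F} (hu : valuation F u = 1) :
    ‖(algebraMap F (NormedAlgClosure F) u)⁻¹‖ ≤ 1 := by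
  rw [← map_inv₀, NormedAlgClosure.norm_algebraMap]
  refine (valuation_le_one_iff_norm_le_one u⁻¹).1 ?_
  rw [map_inv₀, hu, inv_one]

/-- ★ **`ℓ_{uⁿ} = n · ℓ_u + ι(ε^c)`** for a unit `u ∈ F` and the tree's `unitKummerLog` (root systems chosen independently for `u` and
`uⁿ`): the multiple `n · ℓ_u` of a calibration term IS a calibration term up to `ι(ℤ_p(1))`. [cite: BlochKato1990, Ex. 3.10.1]
[cite: Kato1993LNM1553, Ch. II §1.4.4] -/
theorem exists_unitKummerLog_pow_eq {u : F} (hu : u ≠ 0) (hval : valuation F u = 1)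
    (hu1 : ‖algebraMap F (NormedAlgClosure F) u‖ ≤ 1) (n : ℕ) (hu1n : ‖algebraMap F (NormedAlgClosure F) (u ^ n)‖ ≤ 1) :
    ∃ c : ℤ_[p], unitKummerLog hp hF (pow_ne_zero n hu) hu1n =
      n * unitKummerLog hp hF hu hu1 + periodLine F p (epsLineEquiv F p c) := by
  obtain ⟨c, hc⟩ := exists_kummerUnitLog_rootTilt_pow_eq hp hF
    ((map_ne_zero_iff _ (algebraMap F (NormedAlgClosure F)).injective).2 hu) hu1
    (norm_algebraMap_inv_le_one_of_valuation_eq_one hval) (map_pow (algebraMap F (NormedAlgClosure F)) u n)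
    ((map_ne_zero_iff _ (algebraMap F (NormedAlgClosure F)).injective).2 (pow_ne_zero n hu)) hu1n
  exact ⟨c, by rw [periodLine_epsLineEquiv]; exact hc⟩

/-! ## §4 Principal units with prescribed logarithm and `ũ₀ = 1` -/

omit [IsAdicComplete (Ideal.span {(p : integerC F)}) (integerC F)] in
/-- ★ **`ũ₀ = 1` when `‖u − 1‖ ≤ ‖p‖`**: the `0`-th coefficient of the root system of `u` is `u mod p𝒪_{ℂ_F}`.
[cite: FontaineAsterisque223III, Exp. II §1.2.2] -/
theorem coeff_zero_rootTilt_eq_one_of_norm_sub_one_le {x : NormedAlgClosure F} (hx1 : ‖x‖ ≤ 1)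
    (hx : ‖(x : CompletedAlgClosure F) - 1‖ ≤ ‖(p : CompletedAlgClosure F)‖) : PreTilt.coeff 0 (rootTilt p x hx1) = 1 := by
  have hp0 : ((p : integerC F) : CompletedAlgClosure F) ≠ 0 := by
    rw [coe_natCast_integerC]; exact natCast_C_ne_zero (Fact.out : p.Prime).ne_zero
  rw [coeff_rootTilt, ← (Ideal.Quotient.mk (Ideal.span {(p : integerC F)})).map_one, Ideal.Quotient.eq,
    ← pow_one (Ideal.span {(p : integerC F)}), mem_span_pow_iff hp0 1, pow_one, coe_natCast_integerC]
  convert hx using 2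
  rw [AddSubgroupClass.coe_sub, OneMemClass.coe_one]
  rfl

omit [Fact (¬ IsUnit (p : integerC F))] [IsAdicComplete (Ideal.span {(p : integerC F)}) (integerC F)] in
/-- ★ **Principal units with prescribed logarithm.** For every `a ∈ F` and `k₀` there are `k ≥ k₀` and `u ∈ F` with
**`‖1 − u‖ ≤ ‖p‖²`** (for the `ℚ_p`-normalised norm; so `u` is a unit, `u ≡ 1 (mod p)`) and **`log_p u = p^k · a`**: the logarithm series
maps `{‖1 − u‖ ≤ ‖p‖²}` onto `{‖z‖ ≤ ‖p‖²}` (IUT `exists_logSeries_eq`, `‖p‖² · p^{1/(p−1)} ≤ p⁻¹ < 1`), and `p^k a → 0`.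
[cite: NeukirchANT1999, Ch. II (5.5)] [cite: Kato1993LNM1553, Ch. II proof of Lemma 1.4.5] -/
theorem _root_.Literature.NumberTheory.PAdicHodge.PadicField.exists_one_unit_unitLog_eq_pow_smul (a : F) (k₀ : ℕ) :
    ∃ (k : ℕ) (u : F), k₀ ≤ k ∧ (letI := PadicField.normedField F p hp; ‖1 - u‖ ≤ (p : ℝ)⁻¹ * (p : ℝ)⁻¹) ∧
      (letI := LocalField.padicAlgebra F p hp; letI := PadicField.normedField F p hp; unitLog u = ((p : ℚ_[p]) ^ k) • a) := by
  letI := LocalField.padicAlgebra F p hp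
  letI := PadicField.normedField F p hp
  letI := PadicField.normedAlgebra F p hp
  haveI := PadicField.isUltrametricDist F p hp
  haveI := PadicField.completeSpace F p hp
  have hprime : p.Prime := Fact.out
  have hp1 : (1 : ℝ) < p := by exact_mod_cast hprime.one_lt
  have hp0 : (0 : ℝ) < p := by linarith
  set ρ : ℝ := (p : ℝ)⁻¹ * (p : ℝ)⁻¹ with hρ
  have hρ0 : 0 < ρ := mul_pos (inv_pos.2 hp0) (inv_pos.2 hp0)
  have hθ : ρ * (p : ℝ) ^ (1 / ((p : ℝ) - 1)) < 1 := by
    have h2 : (2 : ℝ) ≤ p := by exact_mod_cast hprime.two_le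
    have hexp : 1 / ((p : ℝ) - 1) ≤ 1 := by rw [div_le_one (by linarith)]; linarith
    have hle : (p : ℝ) ^ (1 / ((p : ℝ) - 1)) ≤ p := by
      conv_rhs => rw [← Real.rpow_one (p : ℝ)]
      exact Real.rpow_le_rpow_of_exponent_le hp1.le hexp
    calc ρ * (p : ℝ) ^ (1 / ((p : ℝ) - 1)) ≤ ρ * p := mul_le_mul_of_nonneg_left hle hρ0.le
      _ = (p : ℝ)⁻¹ := by rw [hρ]; field_simp
      _ < 1 := inv_lt_one_of_one_lt₀ hp1
  -- `p^k a → 0`: some `k ≥ k₀` with `‖p^k • a‖ ≤ ρ`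
  obtain ⟨k, hk₀, hk⟩ : ∃ k : ℕ, k₀ ≤ k ∧ ‖((p : ℚ_[p]) ^ k) • a‖ ≤ ρ := by
    have ht : Filter.Tendsto (fun k : ℕ => ‖a‖ * ((p : ℝ)⁻¹) ^ k) Filter.atTop (nhds (‖a‖ * 0)) :=
      (tendsto_pow_atTop_nhds_zero_of_lt_one (inv_pos.2 hp0).le (inv_lt_one_of_one_lt₀ hp1)).const_mul _
    rw [mul_zero] at ht
    obtain ⟨k, hk⟩ := ((ht.eventually (eventually_le_nhds hρ0)).and (Filter.eventually_ge_atTop k₀)).exists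
    refine ⟨k, hk.2, ?_⟩
    rw [norm_smul, norm_pow, Padic.norm_p, mul_comm]
    exact hk.1
  obtain ⟨u, hu1, huz⟩ := exists_logSeries_eq p F hθ hk
  have hρ1 : ρ < 1 := by
    have : ρ ≤ (p : ℝ)⁻¹ := by
      rw [hρ]; exact mul_le_of_le_one_right (inv_nonneg.2 hp0.le) (inv_lt_one_of_one_lt₀ hp1).le
    exact this.trans_lt (inv_lt_one_of_one_lt₀ hp1)
  have huP : IsPrincipal u := hu1.trans_lt hρ1
  exact ⟨k, u, hk₀, hu1, by rw [unitLog_of_isPrincipal p huP, huz]⟩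

omit [IsAdicComplete (Ideal.span {(p : integerC F)}) (integerC F)] in
/-- ★ **The consequences used by the assembly**: for `u` with `‖1 − u‖ ≤ ‖p‖²` (normalised norm) one has `u ≠ 0`, `valuation u = 1`,
`‖ι u‖ ≤ 1` in `F̄`, and `ũ₀ = 1` for the root system `ũ = rootTilt (ι u)`. [cite: NeukirchANT1999, Ch. II (5.5)]
[cite: FontaineAsterisque223III, Exp. II §1.2.2] -/
theorem one_unit_props {u : F} (hu : letI := PadicField.normedField F p hp; ‖1 - u‖ ≤ (p : ℝ)⁻¹ * (p : ℝ)⁻¹) :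
    u ≠ 0 ∧ valuation F u = 1 ∧ ∃ hu1 : ‖algebraMap F (NormedAlgClosure F) u‖ ≤ 1,
      PreTilt.coeff 0 (rootTilt p (algebraMap F (NormedAlgClosure F) u) hu1) = 1 := by
  letI := LocalField.padicAlgebra F p hp
  letI := PadicField.normedField F p hp
  letI := PadicField.normedAlgebra F p hp
  haveI := PadicField.isUltrametricDist F p hp
  have hprime : p.Prime := Fact.out
  have hp1 : (1 : ℝ) < p := by exact_mod_cast hprime.one_lt
  have hp0 : (0 : ℝ) < p := by linarith
  have hpinv : (p : ℝ)⁻¹ < 1 := inv_lt_one_of_one_lt₀ hp1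
  have hle : ‖1 - u‖ ≤ (p : ℝ)⁻¹ := hu.trans (mul_le_of_le_one_right (inv_nonneg.2 hp0.le) hpinv.le)
  have huP : IsPrincipal u := hle.trans_lt hpinv
  have hval : valuation F u = 1 := (PadicField.norm_eq_one_iff F p hp u).1 huP.norm_eq_one
  have hu0 : u ≠ 0 := fun h => by rw [h, map_zero] at hval; exact zero_ne_one hval
  have hu1 : ‖algebraMap F (NormedAlgClosure F) u‖ ≤ 1 := by
    rw [NormedAlgClosure.norm_algebraMap]; exact (valuation_le_one_iff_norm_le_one u).1 hval.le
  refine ⟨hu0, hval, hu1, coeff_zero_rootTilt_eq_one_of_norm_sub_one_le hu1 ?_⟩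
  -- `‖ι u − 1‖_{ℂ_F} ≤ ‖p‖_{ℂ_F}`: both sides are `s`-th powers of the normalised norms
  have e1 : ((algebraMap F (NormedAlgClosure F) u : NormedAlgClosure F) : CompletedAlgClosure F) - 1 =
      algebraMap F (CompletedAlgClosure F) (u - 1) := by
    rw [map_sub, map_one, CompletedAlgClosure.algebraMap_eq_coe]
  have e2 : (p : CompletedAlgClosure F) = algebraMap F (CompletedAlgClosure F) (p : F) := by rw [map_natCast]
  rw [e1, e2, CompletedAlgClosure.norm_algebraMap, CompletedAlgClosure.norm_algebraMap,
    PadicField.norm_val_eq_norm_rpow_normExponent F p hp, PadicField.norm_val_eq_norm_rpow_normExponent F p hp]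
  refine Real.rpow_le_rpow (norm_nonneg _) ?_ (PadicField.normExponent_pos F p hp).le
  rw [PadicField.norm_natCast_p, ← norm_neg, neg_sub]
  exact hle

end BdRPlusTop

end Literature.NumberTheory.PAdicHodge

end
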